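import Literature.AlgebraicGeometry.FormalGeometry.AffineAdicVectorBundleAlgebraization
import Literature.RingTheory.AdicTopology.AdicTruncationHom
import Literature.AlgebraicGeometry.Modules.TildePullback
import HarnessLib

/-!
# Formal completion along `V(I)` is faithful on vector bundles over `Spec` of a separated ring
# (Görtz–Wedhorn II, Prop. 24.88 (2) / Cor. 24.90, faithfulness half, sheaf form)

Görtz–Wedhorn, *Algebraic Geometry II* (2023), §(24.18): for an `I`-adically complete ring `A`,
`M ↦ (M/I^{n+1}M)_n` is an equivalence from finite projective `A`-modules to finite projective
modules over the tower `(A/I^{n+1})_n` (**Prop. 24.88 (2)**), and `ℱ ↦ ℱ_{/Z}` is an equivalence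
from coherent (resp. locally free) modules on `X = Spec A` to coherent (resp. locally free) modules
over `X_{/Z} = (Spec A/I^{n+1})_n` (**Cor. 24.90**). The sibling file
`AffineAdicVectorBundleAlgebraization` proves essential surjectivity on vector bundles, and
`Literature.RingTheory.AdicTopology.AdicTruncationHom` the full faithfulness of Prop. 24.88 (2) on
modules. This file proves the **faithfulness of `ℱ ↦ ℱ_{/Z}` in sheaf form**, which needs only the
SEPARATEDNESS `⋂ₙ Iⁿ = 0` of `A`:

* `isHausdorff_of_projective` — a projective module over an `I`-adically separated ring is
  `I`-adically separated (it is a direct summand of a free module);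
* `tilde_map_ext_of_forall_pullback_adicImmersion` — for `A`-modules `P`, `Q` with `Q` projective,
  two maps `g, g' : P → Q` whose sheafifications `g~, g'~` have the same restriction to every
  thickening `Spec (A/I^{n+1}) → Spec A` are equal: by GW I Prop. 7.24 (2)
  (`Literature.AlgebraicGeometry.Modules.pullbackTildeIso`, natural in the module) the restrictions
  are `(A/I^{n+1} ⊗ g)~`, `~` is faithful, `A/I^{n+1} ⊗_A Q = Q/I^{n+1}Q`, and a map into a separated
  module is determined by its truncations (`eq_of_forall_mapQ_eq`);
* **`hom_ext_of_forall_pullback_adicImmersion`** — for a quasi-coherent `ℱ` and a vector bundle `𝒢`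
  on `Spec A`, morphisms `u, u' : ℱ → 𝒢` with `ι_n^* u = ι_n^* u'` for all `n` are equal
  (`ℱ = Γ(ℱ)~` by quasi-coherence, `𝒢 ≅ Q~` with `Q` finite projective by GW I Cor. 7.42,
  `Literature.AlgebraicGeometry.Modules.exists_tilde_iso_of_isVectorBundle_spec`).

Everything is proved; no named facts.

## References

* U. Görtz, T. Wedhorn, *Algebraic Geometry II: Cohomology of Schemes*, Springer Spektrum 2023,
  Prop. 24.88 (2), Cor. 24.90 (pp. 562–564). [GortzWedhorn2023]
* U. Görtz, T. Wedhorn, *Algebraic Geometry I: Schemes*, 2nd ed. 2020, Prop. 7.24 (2), Cor. 7.42.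
  [GortzWedhorn2020]
-/

noncomputable section

-- `TopCat.Presheaf`/`Scheme.Modules` are not reducible (as in Mathlib's `AlgebraicGeometry/Modules/Tilde.lean`).
set_option backward.isDefEq.respectTransparency false

open CategoryTheory CategoryTheory.Limits AlgebraicGeometry TensorProduct
open Literature.AlgebraicGeometry.Modules Literature.RingTheory.AdicTopology
open scoped ChangeOfRings

namespace Literature.AlgebraicGeometry.FormalGeometry

universe u

/-! ### Projective modules over a separated ring are separated -/

/-- **A projective module over an `I`-adically separated ring is `I`-adically separated**: it is a
direct summand of a free module `⊕ R`, whose coordinates of an element of `⋂ₙ IⁿQ` lie in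
`⋂ₙ Iⁿ = 0`. [folklore] -/
theorem isHausdorff_of_projective {R : Type u} [CommRing R] (I : Ideal R) [IsHausdorff I R]
    (Q : Type u) [AddCommGroup Q] [Module R Q] [Module.Projective R Q] : IsHausdorff I Q := by
  obtain ⟨s, hs⟩ := Module.projective_def'.mp ‹Module.Projective R Q›
  refine ⟨fun x hx => ?_⟩
  have key : s x = 0 := by
    ext q
    rw [Finsupp.zero_apply]
    refine IsHausdorff.haus ‹IsHausdorff I R› _ fun n => ?_
    have hn := hx n
    rw [SModEq.zero] at hn ⊢
    have hmem : (Finsupp.lapply q ∘ₗ s) x ∈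
        (I ^ n • ⊤ : Submodule R Q).map (Finsupp.lapply q ∘ₗ s) := Submodule.mem_map_of_mem hn
    rw [Submodule.map_smul'', Submodule.map_top] at hmem
    exact Submodule.smul_mono le_rfl le_top hmem
  have hx' := LinearMap.congr_fun hs x
  rw [LinearMap.comp_apply, key, map_zero, LinearMap.id_apply] at hx'
  exact hx'.symm

/-! ### Faithfulness of `ℱ ↦ ℱ_{/Z}` on `Spec A` -/

section Faithful

variable (R : CommRingCat.{u}) (I : Ideal R)

/-- **Two maps `g, g' : P → Q` into a projective module whose sheafifications agree on every
thickening `Spec (A/I^{n+1})` are equal** (`A` `I`-adically separated): the restriction of `g~` to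
`Spec (A/I^{n+1})` is `(A/I^{n+1} ⊗ g)~` (GW I Prop. 7.24 (2), naturally in `g`), `~` is faithful,
`A/I^{n+1} ⊗ Q = Q/I^{n+1}Q`, and `Q` is `I`-adically separated.
[cite: GortzWedhorn2023, Prop. 24.88 (2) (p. 562)] -/
theorem tilde_map_ext_of_forall_pullback_adicImmersion [IsHausdorff I R]
    {P Q : ModuleCat.{u} R} [Module.Projective R Q] {g g' : P ⟶ Q}
    (h : ∀ n, (Scheme.Modules.pullback (adicImmersion R I n)).map (tilde.map g) =
      (Scheme.Modules.pullback (adicImmersion R I n)).map (tilde.map g')) :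
    g = g' := by
  haveI : IsHausdorff I Q := isHausdorff_of_projective I Q
  -- Step 1: the base changes `A/I^{n+1} ⊗ g` and `A/I^{n+1} ⊗ g'` agree (naturality of 7.24 (2), `~` faithful)
  have h1 : ∀ n, (ModuleCat.extendScalars.{u, u, u}
      (CommRingCat.ofHom (algebraMap R (R ⧸ I ^ (n + 1)))).hom).map g =
      (ModuleCat.extendScalars.{u, u, u}
        (CommRingCat.ofHom (algebraMap R (R ⧸ I ^ (n + 1)))).hom).map g' := by
    intro n
    have key : (pullbackTildeIso (CommRingCat.ofHom (algebraMap R (R ⧸ I ^ (n + 1)))) P).hom ≫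
        tilde.map ((ModuleCat.extendScalars.{u, u, u}
          (CommRingCat.ofHom (algebraMap R (R ⧸ I ^ (n + 1)))).hom).map g) =
        (pullbackTildeIso (CommRingCat.ofHom (algebraMap R (R ⧸ I ^ (n + 1)))) P).hom ≫
        tilde.map ((ModuleCat.extendScalars.{u, u, u}
          (CommRingCat.ofHom (algebraMap R (R ⧸ I ^ (n + 1)))).hom).map g') := by
      rw [← pullbackTildeIso_hom_naturality, ← pullbackTildeIso_hom_naturality]
      exact congrArg (· ≫ _) (h n)
    exact (tilde.functor _).map_injective ((cancel_epi _).mp key)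
  -- Step 2: hence the truncations `g mod I^{n+1}` agree
  have h2 : ∀ n, Submodule.mapQ _ _ g.hom (smul_top_le_comap_smul_top (I ^ (n + 1)) g.hom) =
      Submodule.mapQ _ _ g'.hom (smul_top_le_comap_smul_top (I ^ (n + 1)) g'.hom) := by
    intro n
    refine Submodule.linearMap_qext _ (LinearMap.ext fun m => ?_)
    rw [LinearMap.comp_apply, LinearMap.comp_apply, Submodule.mkQ_apply, mapQ_smulTop_mk,
      mapQ_smulTop_mk]
    apply (TensorProduct.quotTensorEquivQuotSMul Q (I ^ (n + 1))).symm.injective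
    rw [TensorProduct.quotTensorEquivQuotSMul_symm_mk, TensorProduct.quotTensorEquivQuotSMul_symm_mk]
    have h1' : ((1 : R ⧸ I ^ (n + 1)) ⊗ₜ[R, algebraMap R (R ⧸ I ^ (n + 1))] g.hom m :
        (ModuleCat.extendScalars.{u, u, u} (algebraMap R (R ⧸ I ^ (n + 1)))).obj Q) =
        (1 : R ⧸ I ^ (n + 1)) ⊗ₜ[R, algebraMap R (R ⧸ I ^ (n + 1))] g'.hom m := by
      have := congrArg (fun ψ => (ModuleCat.Hom.hom ψ)
        ((1 : R ⧸ I ^ (n + 1)) ⊗ₜ[R, algebraMap R (R ⧸ I ^ (n + 1))] m)) (h1 n)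
      exact this
    calc (1 : R ⧸ I ^ (n + 1)) ⊗ₜ[R] g.hom m
        = (extendScalarsToBaseChange (S := R ⧸ I ^ (n + 1)) Q).hom
            ((1 : R ⧸ I ^ (n + 1)) ⊗ₜ[R, algebraMap R (R ⧸ I ^ (n + 1))] g.hom m) :=
          (extendScalarsToBaseChange_one_tmul Q _).symm
      _ = (extendScalarsToBaseChange (S := R ⧸ I ^ (n + 1)) Q).hom
            ((1 : R ⧸ I ^ (n + 1)) ⊗ₜ[R, algebraMap R (R ⧸ I ^ (n + 1))] g'.hom m) := by
          rw [h1']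
      _ = (1 : R ⧸ I ^ (n + 1)) ⊗ₜ[R] g'.hom m := extendScalarsToBaseChange_one_tmul Q _
  -- Step 3: a map into a separated module is determined by its truncations
  exact ModuleCat.hom_ext (eq_of_forall_mapQ_eq I h2)

/-- **Görtz–Wedhorn II, Cor. 24.90 / Prop. 24.88 (2), faithfulness of `ℱ ↦ ℱ_{/Z}` on `Spec A`**
(`A` `I`-adically separated): for `ℱ` quasi-coherent and `𝒢` locally free of finite type on
`Spec A`, two morphisms `u, u' : ℱ → 𝒢` with the same restriction to every thickening
`Spec (A/I^{n+1}) → Spec A` are equal (`ℱ = Γ(ℱ)~`, `𝒢 ≅ Q~` with `Q` finite projective by GW I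
Cor. 7.42, and `tilde_map_ext_of_forall_pullback_adicImmersion`).
[cite: GortzWedhorn2023, Cor. 24.90 with Prop. 24.88 (2) (pp. 562–564)] -/
theorem hom_ext_of_forall_pullback_adicImmersion [IsHausdorff I R]
    {F G : (Spec R).Modules} [F.IsQuasicoherent] (hG : Motives.IsVectorBundle G)
    {u u' : F ⟶ G}
    (h : ∀ n, (Scheme.Modules.pullback (adicImmersion R I n)).map u =
      (Scheme.Modules.pullback (adicImmersion R I n)).map u') :
    u = u' := by
  -- `F = Γ(F)~` and `G ≅ Q~` with `Q` finite projective
  haveI : IsIso F.fromTildeΓ := (isQuasicoherent_iff_isIso_fromTildeΓ F).mp inferInstance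
  obtain ⟨Q, -, hQ, ⟨eG⟩⟩ := exists_tilde_iso_of_isVectorBundle_spec G hG
  haveI : Module.Projective R Q := hQ
  let eF := asIso F.fromTildeΓ
  -- the conjugated maps `Γ(F)~ → Q~` come from module maps
  let g := (tilde.functor _).preimage (eF.hom ≫ u ≫ eG.inv)
  let g' := (tilde.functor _).preimage (eF.hom ≫ u' ≫ eG.inv)
  have hg : tilde.map g = eF.hom ≫ u ≫ eG.inv := (tilde.functor _).map_preimage _
  have hg' : tilde.map g' = eF.hom ≫ u' ≫ eG.inv := (tilde.functor _).map_preimage _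
  have hgg' : g = g' := by
    refine tilde_map_ext_of_forall_pullback_adicImmersion R I fun n => ?_
    rw [hg, hg', Functor.map_comp, Functor.map_comp, Functor.map_comp, Functor.map_comp, h n]
  have := hg.symm.trans ((congrArg tilde.map hgg').trans hg')
  rw [← cancel_epi eF.hom, ← cancel_mono eG.inv]
  simpa only [Category.assoc] using this

end Faithful

end Literature.AlgebraicGeometry.FormalGeometry
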